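import Summits.BirchSwinnertonDyer.BirchSwinnertonDyer.Theorems.KimAtThreeSemiLocalTraceDualCyc
import Summits.BirchSwinnertonDyer.BirchSwinnertonDyer.Theorems.KimAtThreeShallowEqDeepAnomalousGlue
import Mathlib.RingTheory.Trace.Basic
import HarnessLib

/-!
# Route `KimAtThreeKolyvagin` (W2): TWISTED trace duals of the semi-local lattice — the adjoint of
# `Σ_g Θ_g·(1 ⊗ σ_g)` for `Tr_{(ℚ_p ⊗ ℚ(ζ_m))/ℚ_p}` is `Σ_g Θ_{g⁻¹}·(1 ⊗ σ_g)`, and the dual of a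
# twisted lattice `Θ·L_int` / `Θ⁻¹L_int` is `(Θ*)⁻¹L_int` / `Θ*·L_int`

Cell `bsd-addord`, seat `bsd-addord-w2-acc3` (PROGRAMME PART 1b row (3), gen 6); fifth file of the
trace-duality set (`KimAtThreeSemiLocalTraceDual{,Cyc,Level,Local}`, gen 5);
`--supports stmt-BirchSwinnertonDyer-19679` (helper).  TOOL theorems only (no definition, no named fact,
no instance, no `sorry`); pure algebra of `Gal(ℚ(ζ_m)/ℚ) ≅ (ℤ/m)ˣ` acting on `ℚ_p ⊗_ℚ ℚ(ζ_m)`; nothing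
about any curve, cocycle, `exp*` or `L`-value is used or asserted; closes nothing; nothing booked.

WHY.  Gen 5 proved the semi-local integer lattice `L = cycIntLattice p m = ℤ_p⟨1 ⊗ ζ_m^j⟩` SELF-DUAL for
the trace form when `p ∤ m` (`KimAtThreeSemiLocalTraceDualCyc.mem_cycIntLattice_iff_forall_norm_trace_mul_le_one`)
— enough for the uniform road's CRUDE bound (clause X1-int_b / (LAT_b)).  Seat w2-c4 gen 9's EXACT
lattice lemma on the good anomalous rows (memo `W2C4-ANOMALOUS-PORT-g9.md` §2 (d):
`log_ω(E(K) ⊗ ℤ_p) = E_p(φ)⁻¹·𝒪_K` hence `exp*_ω(H¹(K,T)) = E_p(φ⁻¹)·𝒪_K` "by trace duality (adjoint of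
`g(φ)` is `g(φ⁻¹)`)") and the rider (ii_τ) of its fine package (C1_τ)
(`KimAtThreeShallowEqDeepAnomalousFineKato`, lattice `3^{k+1}·Σ_g (P_w)_g • (1 ⊗ σ_g) L_int`,
`P_w = 3 − a₃δ_w + δ_{w²}`) use the TWISTED form of that duality, which gen 5 recorded as "follows from
`Tr(σx·y) = Tr(x·σ⁻¹y)`, not written".  This file writes it, in the group-ring ACTION currency of
n1011-p02's evaluation dictionary E-B (`GroupRingEval.lift_apply_eq_sum_padic`:
`Θ·v := Σ_{g ∈ (ℤ/m)ˣ} Θ_g • (1 ⊗ σ_g) v`) — exactly the lattice expression of (ii_τ):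

* §1 `trace_tensorSigma` — `Tr((1 ⊗ σ_g) v) = Tr(v)` (`1 ⊗ σ_g` is the `ℚ_p`-algebra automorphism
  `Algebra.TensorProduct.congr refl σ_g`; `Algebra.trace_eq_of_algEquiv`); `tensorSigma_mul_apply`,
  `tensorSigma_one_apply` (the action is a group action); ★ `trace_tensorSigma_mul` — ADJOINTNESS
  `Tr((1 ⊗ σ_g)x · y) = Tr(x · (1 ⊗ σ_{g⁻¹})y)`.  (`ℤ_p`-linearity of `1 ⊗ σ_g` is seat w2-c4's
  `KimAtThreeShallowEqDeepAnomalousGlue.tensorSigma_smul`, imported.)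
* §2 ★★ `trace_sum_smul_tensorSigma_mul` — for any coefficients `c : (ℤ/m)ˣ → ℚ_p`:
  `Tr((Σ_g c_g • σ_g x)·y) = Tr(x · Σ_g c_{g⁻¹} • σ_g y)` (the adjoint of `Θ` is `Θ* := Θ ∘ inv`);
  `trace_twist_mul_eq_of_coeff_inv` (the `ℤ_p[(ℤ/m)ˣ]` spelling with `Θ'_g = Θ_{g⁻¹}`).
* §3 `tensorSigma_mem_cycIntLattice` (`σ_g ζ^j = ζ^{gj}`: the lattice is Galois-stable),
  `sum_smul_tensorSigma_mem_cycIntLattice` (`Θ·L ⊆ L` for integral `Θ`); the TWISTED DUALS: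
  `forall_norm_trace_twist_mul_le_one_iff` (`p ∤ m`): **`y ∈ (Θ·L)^∨ ↔ Θ*·y ∈ L`**;
  `norm_trace_mul_le_one_of_eq_twist` (any `m`): `Θ*·L ⊆ (Θ⁻¹L)^∨`, `Θ⁻¹L := {x : Θ·x ∈ L}`;
  ★★★ `forall_norm_trace_mul_le_one_iff_exists_eq_twist` (`p ∤ m`, `Θ` and `Θ*` acting ONTO
  `ℚ_p ⊗ ℚ(ζ_m)`): **`(Θ⁻¹L)^∨ = Θ*·L`** — the semi-local form of "the dual of `E_p(φ)⁻¹·𝒪_K` is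
  `E_p(φ⁻¹)·𝒪_K`" (per factor, `𝒪_K^∨ = 𝒪_K` is gen 5's `KimAtThreeSemiLocalTraceDualLocal`).
The surjectivity of the Euler twist `Θ_w = p − a·δ_w + δ_{w²}` (and of `Θ_w* = Θ_{w⁻¹}`) for
`a ≠ ±(p+1)` — so for every `a_p` in the Hasse range — is the companion file
`KimAtThreeSemiLocalTraceDualTwistEuler`.

HONEST LIMITS: pure algebra; `p ∤ m` for the `iff`s (tame Kolyvagin levels — at `p ∣ m` the lattice is not
self-dual); the identification of `log_ω(E(K) ⊗ ℤ_p)` with `E_p(φ)⁻¹·𝒪_K` (formal groups + an index count)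
and the duality PAIRING `Tr(log_ω · exp*_ω) ∈ ℤ_p` ([BK90] Prop. 3.8 + local Tate duality, cite item (S5b))
are NOT here.

References: [Kim2022StructureSelmer] Lemma 3.4, Cor. 3.5, §3.4.1 and the proof of Thm. 3.13 (the lattice
`ℤ_p ⊗ ℤ[ζ_n]` and `exp*(H¹(ℚ_p,T)) = (#Ẽ(𝔽_p)/p)ℤ_p`); [Kato2004Asterisque] (5.7.1) p. 157 (`σ_b`),
Thm. 9.7, Ex. 13.3; [BlochKato1990] Prop. 3.8; A. Fröhlich, *Galois module structure of algebraic integers*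
(1983) I §2–§3 (adjoints in `K[G]` for the trace form) / J. Neukirch, *Algebraic Number Theory* III (2.4)
[folklore].
-/

set_option autoImplicit false
-- the Theorems namespace of a single-conjunct summit repeats the summit name by design (D-0017)
set_option linter.dupNamespace false
-- `CyclotomicField m ℚ`'s two `ℚ`-algebra structures agree only up to unfolding (as in the sibling files)
set_option backward.isDefEq.respectTransparency false

noncomputable section

open scoped TensorProduct NumberField BigOperators
open NumberField IsDedekindDomain
open Literature.NumberTheory.EllipticCurves.Kato2004.EulerSystemValues
open Summit.BirchSwinnertonDyer.Rank1Residual.GaloisImage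
open Summit.BirchSwinnertonDyer.Rank1Residual.GaloisImage.GroupRingEval
open Summit.BirchSwinnertonDyer.BirchSwinnertonDyer.Theorems.KimAtThreePortSharedSATCore
open Summit.BirchSwinnertonDyer.BirchSwinnertonDyer.Theorems.KimAtThreeSemiLocalTraceDualCyc

namespace Summit.BirchSwinnertonDyer.BirchSwinnertonDyer.Theorems.KimAtThreeSemiLocalTraceDualTwist

variable (m : ℕ) [NeZero m] (p : ℕ) [Fact p.Prime]

/-! ### §1 `1 ⊗ σ_g` is a `ℚ_p`-algebra automorphism of `ℚ_p ⊗ ℚ(ζ_m)`: trace invariance, adjointness -/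

/-- The tree's `1 ⊗ σ_g = Algebra.TensorProduct.map (AlgHom.id ℚ ℚ_p) σ_g` (the `ZetaBody` (C3a) / E-B /
(ii_τ) spelling) agrees pointwise with the `ℚ_p`-ALGEBRA AUTOMORPHISM `Algebra.TensorProduct.congr refl σ_g`
of `ℚ_p ⊗_ℚ ℚ(ζ_m)`. [folklore] -/
theorem tensorSigma_eq_congr_apply (g : (ZMod m)ˣ) (v : ℚ_[p] ⊗[ℚ] CyclotomicField m ℚ) :
    Algebra.TensorProduct.map (AlgHom.id ℚ ℚ_[p])
        (sigma m g : CyclotomicField m ℚ →ₐ[ℚ] CyclotomicField m ℚ) v =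
      Algebra.TensorProduct.congr (AlgEquiv.refl : ℚ_[p] ≃ₐ[ℚ_[p]] ℚ_[p]) (sigma m g) v := by
  induction v using TensorProduct.induction_on with
  | zero => rw [map_zero, map_zero]
  | tmul a z =>
    rw [Algebra.TensorProduct.map_tmul, Algebra.TensorProduct.congr_apply,
      Algebra.TensorProduct.map_tmul]
    rfl
  | add u w hu hw => rw [map_add, map_add, hu, hw]

/-- **Trace invariance**: `Tr_{(ℚ_p ⊗ ℚ(ζ_m))/ℚ_p}((1 ⊗ σ_g) v) = Tr(v)` — the trace is invariant under
the algebra automorphism `1 ⊗ σ_g` (`Algebra.trace_eq_of_algEquiv`). [folklore] -/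
theorem trace_tensorSigma (g : (ZMod m)ˣ) (v : ℚ_[p] ⊗[ℚ] CyclotomicField m ℚ) :
    Algebra.trace ℚ_[p] (ℚ_[p] ⊗[ℚ] CyclotomicField m ℚ)
        (Algebra.TensorProduct.map (AlgHom.id ℚ ℚ_[p])
          (sigma m g : CyclotomicField m ℚ →ₐ[ℚ] CyclotomicField m ℚ) v) =
      Algebra.trace ℚ_[p] (ℚ_[p] ⊗[ℚ] CyclotomicField m ℚ) v := by
  rw [tensorSigma_eq_congr_apply]
  exact Algebra.trace_eq_of_algEquiv _ v

/-- `1 ⊗ σ_1 = id` on `ℚ_p ⊗ ℚ(ζ_m)`. [folklore] -/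
theorem tensorSigma_one_apply (v : ℚ_[p] ⊗[ℚ] CyclotomicField m ℚ) :
    Algebra.TensorProduct.map (AlgHom.id ℚ ℚ_[p])
        (sigma m 1 : CyclotomicField m ℚ →ₐ[ℚ] CyclotomicField m ℚ) v = v := by
  have h1 : sigma m 1 = AlgEquiv.refl := by
    unfold sigma
    rw [map_one]
    rfl
  rw [h1]
  induction v using TensorProduct.induction_on with
  | zero => rw [map_zero]
  | tmul a z => rw [Algebra.TensorProduct.map_tmul]; rfl
  | add u w hu hw => rw [map_add, hu, hw]

/-- `1 ⊗ σ_{ab} = (1 ⊗ σ_a) ∘ (1 ⊗ σ_b)` on `ℚ_p ⊗ ℚ(ζ_m)` (`σ_{ab} = σ_a ∘ σ_b`, the tree's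
`CharSum.sigma_mul_apply`). [cite: Kato2004Asterisque, (5.7.1) (p. 157)] -/
theorem tensorSigma_mul_apply (a b : (ZMod m)ˣ) (v : ℚ_[p] ⊗[ℚ] CyclotomicField m ℚ) :
    Algebra.TensorProduct.map (AlgHom.id ℚ ℚ_[p])
        (sigma m (a * b) : CyclotomicField m ℚ →ₐ[ℚ] CyclotomicField m ℚ) v =
      Algebra.TensorProduct.map (AlgHom.id ℚ ℚ_[p])
        (sigma m a : CyclotomicField m ℚ →ₐ[ℚ] CyclotomicField m ℚ)
        (Algebra.TensorProduct.map (AlgHom.id ℚ ℚ_[p])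
          (sigma m b : CyclotomicField m ℚ →ₐ[ℚ] CyclotomicField m ℚ) v) := by
  induction v using TensorProduct.induction_on with
  | zero => rw [map_zero, map_zero, map_zero]
  | tmul s z =>
    simp only [Algebra.TensorProduct.map_tmul, AlgHom.coe_id, id_eq, AlgEquiv.coe_toAlgHom,
      CharSum.sigma_mul_apply]
  | add u w hu hw => rw [map_add, map_add, map_add, hu, hw]

/-- `(1 ⊗ σ_{g⁻¹}) ((1 ⊗ σ_g) v) = v`. [folklore] -/
theorem tensorSigma_inv_mul_apply (g : (ZMod m)ˣ) (v : ℚ_[p] ⊗[ℚ] CyclotomicField m ℚ) :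
    Algebra.TensorProduct.map (AlgHom.id ℚ ℚ_[p])
        (sigma m g⁻¹ : CyclotomicField m ℚ →ₐ[ℚ] CyclotomicField m ℚ)
        (Algebra.TensorProduct.map (AlgHom.id ℚ ℚ_[p])
          (sigma m g : CyclotomicField m ℚ →ₐ[ℚ] CyclotomicField m ℚ) v) = v := by
  rw [← tensorSigma_mul_apply, inv_mul_cancel, tensorSigma_one_apply]

/-- `(1 ⊗ σ_g) ((1 ⊗ σ_{g⁻¹}) v) = v`. [folklore] -/
theorem tensorSigma_mul_inv_apply (g : (ZMod m)ˣ) (v : ℚ_[p] ⊗[ℚ] CyclotomicField m ℚ) :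
    Algebra.TensorProduct.map (AlgHom.id ℚ ℚ_[p])
        (sigma m g : CyclotomicField m ℚ →ₐ[ℚ] CyclotomicField m ℚ)
        (Algebra.TensorProduct.map (AlgHom.id ℚ ℚ_[p])
          (sigma m g⁻¹ : CyclotomicField m ℚ →ₐ[ℚ] CyclotomicField m ℚ) v) = v := by
  rw [← tensorSigma_mul_apply, mul_inv_cancel, tensorSigma_one_apply]

/-- ★ **Adjointness of `1 ⊗ σ_g` for the trace form**:
`Tr((1 ⊗ σ_g)x · y) = Tr(x · (1 ⊗ σ_{g⁻¹})y)` — apply the automorphism `1 ⊗ σ_{g}` to `x · (1 ⊗ σ_{g⁻¹})y`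
and use trace invariance.  (The "adjoint of `g(φ)` is `g(φ⁻¹)`" step of seat w2-c4 gen 9's lattice lemma.)
[folklore] -/
theorem trace_tensorSigma_mul (g : (ZMod m)ˣ) (x y : ℚ_[p] ⊗[ℚ] CyclotomicField m ℚ) :
    Algebra.trace ℚ_[p] (ℚ_[p] ⊗[ℚ] CyclotomicField m ℚ)
        (Algebra.TensorProduct.map (AlgHom.id ℚ ℚ_[p])
          (sigma m g : CyclotomicField m ℚ →ₐ[ℚ] CyclotomicField m ℚ) x * y) =
      Algebra.trace ℚ_[p] (ℚ_[p] ⊗[ℚ] CyclotomicField m ℚ)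
        (x * Algebra.TensorProduct.map (AlgHom.id ℚ ℚ_[p])
          (sigma m g⁻¹ : CyclotomicField m ℚ →ₐ[ℚ] CyclotomicField m ℚ) y) := by
  conv_lhs => rw [← tensorSigma_mul_inv_apply m p g y]
  rw [← map_mul, trace_tensorSigma]

/-- The mirror form: `Tr(x · (1 ⊗ σ_g)y) = Tr((1 ⊗ σ_{g⁻¹})x · y)`. [folklore] -/
theorem trace_mul_tensorSigma (g : (ZMod m)ˣ) (x y : ℚ_[p] ⊗[ℚ] CyclotomicField m ℚ) :
    Algebra.trace ℚ_[p] (ℚ_[p] ⊗[ℚ] CyclotomicField m ℚ)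
        (x * Algebra.TensorProduct.map (AlgHom.id ℚ ℚ_[p])
          (sigma m g : CyclotomicField m ℚ →ₐ[ℚ] CyclotomicField m ℚ) y) =
      Algebra.trace ℚ_[p] (ℚ_[p] ⊗[ℚ] CyclotomicField m ℚ)
        (Algebra.TensorProduct.map (AlgHom.id ℚ ℚ_[p])
          (sigma m g⁻¹ : CyclotomicField m ℚ →ₐ[ℚ] CyclotomicField m ℚ) x * y) := by
  rw [trace_tensorSigma_mul, inv_inv]

/-! ### §2 The adjoint of the group-ring action `Θ·v = Σ_g Θ_g • (1 ⊗ σ_g) v` is `Θ* = Θ ∘ inv` -/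

/-- ★★ **Adjointness of the group-ring action** (any coefficients `c : (ℤ/m)ˣ → ℚ_p`):
`Tr((Σ_g c_g • (1 ⊗ σ_g) x) · y) = Tr(x · Σ_g c_{g⁻¹} • (1 ⊗ σ_g) y)` — termwise ★ and the
reindexing `g ↦ g⁻¹`.  In n1011-p02's E-B currency this reads `Tr((Θ·x)·y) = Tr(x·(Θ*·y))` with
`Θ* = Σ_g Θ_{g⁻¹} δ_g`. [folklore] -/
theorem trace_sum_smul_tensorSigma_mul (c : (ZMod m)ˣ → ℚ_[p])
    (x y : ℚ_[p] ⊗[ℚ] CyclotomicField m ℚ) :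
    Algebra.trace ℚ_[p] (ℚ_[p] ⊗[ℚ] CyclotomicField m ℚ)
        ((∑ g : (ZMod m)ˣ, c g • Algebra.TensorProduct.map (AlgHom.id ℚ ℚ_[p])
          (sigma m g : CyclotomicField m ℚ →ₐ[ℚ] CyclotomicField m ℚ) x) * y) =
      Algebra.trace ℚ_[p] (ℚ_[p] ⊗[ℚ] CyclotomicField m ℚ)
        (x * ∑ g : (ZMod m)ˣ, c g⁻¹ • Algebra.TensorProduct.map (AlgHom.id ℚ ℚ_[p])
          (sigma m g : CyclotomicField m ℚ →ₐ[ℚ] CyclotomicField m ℚ) y) := by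
  rw [Finset.sum_mul, map_sum, Finset.mul_sum, map_sum]
  refine Fintype.sum_equiv (Equiv.inv (ZMod m)ˣ) _ _ fun g => ?_
  rw [Equiv.inv_apply, inv_inv, smul_mul_assoc, map_smul, mul_smul_comm, map_smul,
    trace_tensorSigma_mul]

/-- **`ℤ_p[(ℤ/m)ˣ]` spelling**: for `Θ, Θ′ ∈ ℤ_p[(ℤ/m)ˣ]` with `Θ′_g = Θ_{g⁻¹}` (e.g. the Euler twists
`P_w = p − aδ_w + δ_{w²}` and `P_{w⁻¹}`), `Tr((Θ·x)·y) = Tr(x·(Θ′·y))` in the (ii_τ) lattice currency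
`Σ_g (Θ_g : ℚ_p) • (1 ⊗ σ_g)`. [folklore] -/
theorem trace_twist_mul_eq_of_coeff_inv (Θ Θ' : MonoidAlgebra ℤ_[p] (ZMod m)ˣ)
    (hΘ' : ∀ g, Θ'.coeff g = Θ.coeff g⁻¹) (x y : ℚ_[p] ⊗[ℚ] CyclotomicField m ℚ) :
    Algebra.trace ℚ_[p] (ℚ_[p] ⊗[ℚ] CyclotomicField m ℚ)
        ((∑ g : (ZMod m)ˣ, ((Θ.coeff g : ℤ_[p]) : ℚ_[p]) • Algebra.TensorProduct.map (AlgHom.id ℚ ℚ_[p])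
          (sigma m g : CyclotomicField m ℚ →ₐ[ℚ] CyclotomicField m ℚ) x) * y) =
      Algebra.trace ℚ_[p] (ℚ_[p] ⊗[ℚ] CyclotomicField m ℚ)
        (x * ∑ g : (ZMod m)ˣ, ((Θ'.coeff g : ℤ_[p]) : ℚ_[p]) • Algebra.TensorProduct.map (AlgHom.id ℚ ℚ_[p])
          (sigma m g : CyclotomicField m ℚ →ₐ[ℚ] CyclotomicField m ℚ) y) := by
  simp_rw [hΘ']
  exact trace_sum_smul_tensorSigma_mul m p (fun g => ((Θ.coeff g : ℤ_[p]) : ℚ_[p])) x y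

/-! ### §3 The lattice `cycIntLattice p m` is Galois-stable; twisted duals -/

/-- **`cycIntLattice p m = ℤ_p⟨(1 ⊗ ζ_m)^j⟩` is Galois-stable**: `(1 ⊗ σ_g) l ∈ cycIntLattice p m` for
`l ∈ cycIntLattice p m` (`σ_g(ζ^j) = ζ^{g·j}`, Kato (5.7.1)). [cite: Kato2004Asterisque, (5.7.1) (p. 157)] -/
theorem tensorSigma_mem_cycIntLattice (g : (ZMod m)ˣ) {l : ℚ_[p] ⊗[ℚ] CyclotomicField m ℚ}
    (hl : l ∈ cycIntLattice p m) :
    Algebra.TensorProduct.map (AlgHom.id ℚ ℚ_[p])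
        (sigma m g : CyclotomicField m ℚ →ₐ[ℚ] CyclotomicField m ℚ) l ∈ cycIntLattice p m := by
  unfold cycIntLattice at hl ⊢
  refine Submodule.span_induction
    (p := fun l _ => Algebra.TensorProduct.map (AlgHom.id ℚ ℚ_[p])
        (sigma m g : CyclotomicField m ℚ →ₐ[ℚ] CyclotomicField m ℚ) l ∈ Submodule.span ℤ_[p]
          (Set.range fun j : ℕ =>
            (1 : ℚ_[p]) ⊗ₜ[ℚ] IsCyclotomicExtension.zeta m ℚ (CyclotomicField m ℚ) ^ j)) ?_ ?_ ?_ ?_ hl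
  · rintro _ ⟨j, rfl⟩
    dsimp only
    -- the generator is `(1 ⊗ ζ)^j` (`⊗ₜ` binds tighter than `^`); `σ_g ζ = ζ^g`
    rw [map_pow, Algebra.TensorProduct.map_tmul, AlgHom.coe_id, id_eq, AlgEquiv.coe_toAlgHom,
      sigma_apply_zeta,
      show (1 : ℚ_[p]) ⊗ₜ[ℚ] (IsCyclotomicExtension.zeta m ℚ (CyclotomicField m ℚ) ^ (g : ZMod m).val) =
          ((1 : ℚ_[p]) ⊗ₜ[ℚ] IsCyclotomicExtension.zeta m ℚ (CyclotomicField m ℚ)) ^ (g : ZMod m).val by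
        rw [Algebra.TensorProduct.tmul_pow, one_pow],
      ← pow_mul]
    exact Submodule.subset_span ⟨_, rfl⟩
  · rw [map_zero]
    exact zero_mem _
  · intro x y _ _ hx hy
    rw [map_add]
    exact add_mem hx hy
  · intro r x _ hx
    rw [KimAtThreeShallowEqDeepAnomalousGlue.tensorSigma_smul]
    exact Submodule.smul_mem _ r hx

/-- **`Θ·L ⊆ L` for integral `Θ`**: `Σ_g (c_g : ℚ_p) • (1 ⊗ σ_g) l ∈ cycIntLattice p m` for `l` in the
lattice and `c : (ℤ/m)ˣ → ℤ_p` (so the twisted lattice `(1 ⊗ P_w)·L_int` of (ii_τ) sits inside `L_int`).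
[folklore] -/
theorem sum_smul_tensorSigma_mem_cycIntLattice (c : (ZMod m)ˣ → ℤ_[p])
    {l : ℚ_[p] ⊗[ℚ] CyclotomicField m ℚ} (hl : l ∈ cycIntLattice p m) :
    ∑ g : (ZMod m)ˣ, ((c g : ℤ_[p]) : ℚ_[p]) • Algebra.TensorProduct.map (AlgHom.id ℚ ℚ_[p])
        (sigma m g : CyclotomicField m ℚ →ₐ[ℚ] CyclotomicField m ℚ) l ∈ cycIntLattice p m := by
  refine Submodule.sum_mem _ fun g _ => ?_
  rw [← padicInt_smul_eq_coe_smul]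
  exact Submodule.smul_mem _ _ (tensorSigma_mem_cycIntLattice m p g hl)

/-- **`y ∈ (Θ·L)^∨ ⟹ Θ*·y ∈ L^∨`** (any `m`; `L = cycIntLattice p m`, `L^∨` the trace dual
`{a : ‖Tr(a·l)‖ ≤ 1 ∀ l ∈ L}`): if `‖Tr((Θ·l)·y)‖ ≤ 1` for all `l ∈ L` then `‖Tr((Θ*·y)·l)‖ ≤ 1` for all
`l ∈ L` — ★★ read backwards. [folklore] -/
theorem forall_norm_trace_twist_inv_mul_le_one (c : (ZMod m)ˣ → ℤ_[p])
    {y : ℚ_[p] ⊗[ℚ] CyclotomicField m ℚ}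
    (hy : ∀ l ∈ cycIntLattice p m, ‖Algebra.trace ℚ_[p] (ℚ_[p] ⊗[ℚ] CyclotomicField m ℚ)
      ((∑ g : (ZMod m)ˣ, ((c g : ℤ_[p]) : ℚ_[p]) • Algebra.TensorProduct.map (AlgHom.id ℚ ℚ_[p])
        (sigma m g : CyclotomicField m ℚ →ₐ[ℚ] CyclotomicField m ℚ) l) * y)‖ ≤ 1) :
    ∀ l ∈ cycIntLattice p m, ‖Algebra.trace ℚ_[p] (ℚ_[p] ⊗[ℚ] CyclotomicField m ℚ)
      ((∑ g : (ZMod m)ˣ, ((c g⁻¹ : ℤ_[p]) : ℚ_[p]) • Algebra.TensorProduct.map (AlgHom.id ℚ ℚ_[p])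
        (sigma m g : CyclotomicField m ℚ →ₐ[ℚ] CyclotomicField m ℚ) y) * l)‖ ≤ 1 := by
  intro l hl
  rw [mul_comm, ← trace_sum_smul_tensorSigma_mul m p (fun g => ((c g : ℤ_[p]) : ℚ_[p])) l y]
  exact hy l hl

/-- **TWISTED DUAL, `p ∤ m`: `y ∈ (Θ·L)^∨ ↔ Θ*·y ∈ L`** (`L = cycIntLattice p m`, `Θ` with `ℤ_p`
coefficients `c`, `Θ*` with coefficients `g ↦ c_{g⁻¹}`): `‖Tr((Σ_g c_g • σ_g l)·y)‖ ≤ 1` for every `l ∈ L`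
iff `Σ_g c_{g⁻¹} • σ_g y ∈ L` — ★★ and gen 5's self-duality `L^∨ = L`.  For the Euler twist
`Θ = P_w = p − aδ_w + δ_{w²}` of (ii_τ) this is "`(E_p(φ⁻¹)·𝒪)^∨ = E_p(φ)⁻¹·𝒪`" in semi-local currency.
[cite: Kim2022StructureSelmer, §3.4.1 and the proof of Thm. 3.13 (arXiv v3 pp. 26–28)] -/
theorem forall_norm_trace_twist_mul_le_one_iff (hpm : ¬ p ∣ m) (c : (ZMod m)ˣ → ℤ_[p])
    (y : ℚ_[p] ⊗[ℚ] CyclotomicField m ℚ) :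
    (∀ l ∈ cycIntLattice p m, ‖Algebra.trace ℚ_[p] (ℚ_[p] ⊗[ℚ] CyclotomicField m ℚ)
      ((∑ g : (ZMod m)ˣ, ((c g : ℤ_[p]) : ℚ_[p]) • Algebra.TensorProduct.map (AlgHom.id ℚ ℚ_[p])
        (sigma m g : CyclotomicField m ℚ →ₐ[ℚ] CyclotomicField m ℚ) l) * y)‖ ≤ 1) ↔
    ∑ g : (ZMod m)ˣ, ((c g⁻¹ : ℤ_[p]) : ℚ_[p]) • Algebra.TensorProduct.map (AlgHom.id ℚ ℚ_[p])
        (sigma m g : CyclotomicField m ℚ →ₐ[ℚ] CyclotomicField m ℚ) y ∈ cycIntLattice p m := by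
  rw [mem_cycIntLattice_iff_forall_norm_trace_mul_le_one m p hpm]
  refine forall₂_congr fun l hl => ?_
  rw [mul_comm (∑ g : (ZMod m)ˣ, _) l,
    ← trace_sum_smul_tensorSigma_mul m p (fun g => ((c g : ℤ_[p]) : ℚ_[p])) l y]

/-- **`Θ*·L ⊆ (Θ⁻¹L)^∨`** (any `m`; `Θ⁻¹L := {x : Θ·x ∈ L}`): if `y = Σ_g c_{g⁻¹} • σ_g z` with `z ∈ L`,
then `‖Tr(x·y)‖ ≤ 1` for every `x` with `Θ·x = Σ_g c_g • σ_g x ∈ L` (`Tr(x·Θ*z) = Tr(Θx·z)`, `L·L ⊆ L`,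
`Tr(L) ⊆ ℤ_p`). [folklore] -/
theorem norm_trace_mul_le_one_of_eq_twist (c : (ZMod m)ˣ → ℤ_[p])
    {z : ℚ_[p] ⊗[ℚ] CyclotomicField m ℚ} (hz : z ∈ cycIntLattice p m)
    {x : ℚ_[p] ⊗[ℚ] CyclotomicField m ℚ}
    (hx : ∑ g : (ZMod m)ˣ, ((c g : ℤ_[p]) : ℚ_[p]) • Algebra.TensorProduct.map (AlgHom.id ℚ ℚ_[p])
        (sigma m g : CyclotomicField m ℚ →ₐ[ℚ] CyclotomicField m ℚ) x ∈ cycIntLattice p m) :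
    ‖Algebra.trace ℚ_[p] (ℚ_[p] ⊗[ℚ] CyclotomicField m ℚ)
      (x * ∑ g : (ZMod m)ˣ, ((c g⁻¹ : ℤ_[p]) : ℚ_[p]) • Algebra.TensorProduct.map (AlgHom.id ℚ ℚ_[p])
        (sigma m g : CyclotomicField m ℚ →ₐ[ℚ] CyclotomicField m ℚ) z)‖ ≤ 1 := by
  rw [← trace_sum_smul_tensorSigma_mul m p (fun g => ((c g : ℤ_[p]) : ℚ_[p])) x z]
  exact norm_trace_le_one_of_mem_cycIntLattice p m (mul_mem_cycIntLattice p m hx hz)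

/-- ★★★ **THE DUAL OF A PREIMAGE LATTICE, `p ∤ m`: `(Θ⁻¹L)^∨ = Θ*·L`** when `Θ` and `Θ*` act ONTO
`ℚ_p ⊗ ℚ(ζ_m)` (for the Euler twists: the companion file `KimAtThreeSemiLocalTraceDualTwistEuler`).
For `y ∈ ℚ_p ⊗ ℚ(ζ_m)`: `‖Tr(x·y)‖ ≤ 1` for every `x` with `Θ·x ∈ L` iff `y = Θ*·z` for some `z ∈ L`.
(⇐ is `norm_trace_mul_le_one_of_eq_twist`; ⇒: write `y = Θ*·z`, test `z` against `l = Θ·x ∈ L` using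
`Tr(z·Θx) = Tr(x·Θ*z) = Tr(x·y)`, and conclude `z ∈ L^∨ = L` by gen 5.)  This is the semi-local form of
seat w2-c4 gen 9's step "`log_ω = E_p(φ)⁻¹·𝒪_K` ⟹ `exp*_ω = (log_ω)^∨ = E_p(φ⁻¹)·𝒪_K` by trace
duality". [cite: Kim2022StructureSelmer, Lemma 3.4, Cor. 3.5 and the proof of Thm. 3.13 (arXiv v3 pp. 17–18, 26–28)] -/
theorem forall_norm_trace_mul_le_one_iff_exists_eq_twist (hpm : ¬ p ∣ m) (c : (ZMod m)ˣ → ℤ_[p])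
    (hT : Function.Surjective fun v : ℚ_[p] ⊗[ℚ] CyclotomicField m ℚ =>
      ∑ g : (ZMod m)ˣ, ((c g : ℤ_[p]) : ℚ_[p]) • Algebra.TensorProduct.map (AlgHom.id ℚ ℚ_[p])
        (sigma m g : CyclotomicField m ℚ →ₐ[ℚ] CyclotomicField m ℚ) v)
    (hT' : Function.Surjective fun v : ℚ_[p] ⊗[ℚ] CyclotomicField m ℚ =>
      ∑ g : (ZMod m)ˣ, ((c g⁻¹ : ℤ_[p]) : ℚ_[p]) • Algebra.TensorProduct.map (AlgHom.id ℚ ℚ_[p])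
        (sigma m g : CyclotomicField m ℚ →ₐ[ℚ] CyclotomicField m ℚ) v)
    (y : ℚ_[p] ⊗[ℚ] CyclotomicField m ℚ) :
    (∀ x : ℚ_[p] ⊗[ℚ] CyclotomicField m ℚ,
      ∑ g : (ZMod m)ˣ, ((c g : ℤ_[p]) : ℚ_[p]) • Algebra.TensorProduct.map (AlgHom.id ℚ ℚ_[p])
          (sigma m g : CyclotomicField m ℚ →ₐ[ℚ] CyclotomicField m ℚ) x ∈ cycIntLattice p m →
        ‖Algebra.trace ℚ_[p] (ℚ_[p] ⊗[ℚ] CyclotomicField m ℚ) (x * y)‖ ≤ 1) ↔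
    ∃ z ∈ cycIntLattice p m, y = ∑ g : (ZMod m)ˣ, ((c g⁻¹ : ℤ_[p]) : ℚ_[p]) •
      Algebra.TensorProduct.map (AlgHom.id ℚ ℚ_[p])
        (sigma m g : CyclotomicField m ℚ →ₐ[ℚ] CyclotomicField m ℚ) z := by
  constructor
  · intro h
    obtain ⟨z, rfl⟩ := hT' y
    refine ⟨z, ?_, rfl⟩
    rw [mem_cycIntLattice_iff_forall_norm_trace_mul_le_one m p hpm]
    intro l hl
    obtain ⟨x, rfl⟩ := hT l
    have hx := h x hl
    rwa [← trace_sum_smul_tensorSigma_mul m p (fun g => ((c g : ℤ_[p]) : ℚ_[p])) x z, mul_comm] at hx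
  · rintro ⟨z, hz, rfl⟩ x hx
    exact norm_trace_mul_le_one_of_eq_twist m p c hz hx

end Summit.BirchSwinnertonDyer.BirchSwinnertonDyer.Theorems.KimAtThreeSemiLocalTraceDualTwist

end
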